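import Summits.BirchSwinnertonDyer.BirchSwinnertonDyer.Theorems.QuadraticBranchSignedControlPlusEtaNonsurjCartanFieldFrobenius
import Literature.NumberTheory.EllipticCurves.IsogenyQuadraticTwistProofs
import Literature.NumberTheory.EllipticCurves.QuadraticTwistJInvariantProofs
import Literature.NumberTheory.EllipticCurves.QuadraticTwistSelmerPInfty
import Literature.NumberTheory.EllipticCurves.QuadraticBaseChangeGaloisProofs
import Literature.NumberTheory.EllipticCurves.BSDInvariantsProofs
import Literature.NumberTheory.GaloisRepresentations.IntegralGaloisActionProofs
import HarnessLib

/-!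
# Route `QuadraticBranchSignedControl` (rung K8, cell `bsd-potss`): crux stmt-BirchSwinnertonDyer-19606
# `PlusEtaMainConjectureNonsurj` — CONGRUENCE UP TO A QUADRATIC TWIST READS `a_ℓ` UP TO SIGN: if `V[p] ≅ A[p]` and `A` has the
# `j`-invariant of a reference curve `A₀` (`j ≠ 0, 1728`), then `a_ℓ(V) ≡ ±a_ℓ(A₀) (mod p)` at every common good prime `ℓ ≠ p`

WHAT. The finer door for the rows of crux 19606 whose Cartan field IS one of the nine class-number-one fields but which carry no
CM-curve anchor (g5's «wrong cubic class»; 22 of the 336 height-≤20 `X_ns⁺(5)` rows). A CM anchor `A` with `j(A) = j₀ ∉ {0, 1728}` is a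
quadratic twist of any fixed reference curve `A₀` with `j(A₀) = j₀` (Silverman X.5.4, tree `exists_variableChange_eq_quadraticTwist_of_j_eq`),
so — with NO hypothesis on the bad primes of `A` —

* §1 `exists_twistedTorsionIso_of_modPCongruent_of_j_eq`: `V[p] ≅ A₀[p]` by an additive isomorphism which is `Γ_ℚ`-equivariant UP TO THE
  KUMMER SIGN of `√D` (composition of the congruence, the `ℚ`-isomorphism `A ≅ A₀'^{(D)}`, the twisting isomorphism `untwistEquiv` over
  `ℚ(√D)` and `A₀' ≅ A₀`);
* §2 `trace_eq_mul_trace_of_twistedIso`: along such an isomorphism the `𝔽_p`-traces of any `σ` differ by the sign `±1`;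
* §3 **`dvd_frobeniusTrace_sub_or_add_of_modPCongruent_of_j_eq`**: for globally minimal `V`, `A₀` both good at a prime `ℓ ≠ p`:
  `p ∣ a_ℓ(V) − a_ℓ(A₀)` or `p ∣ a_ℓ(V) + a_ℓ(A₀)` (trace of an arithmetic Frobenius on the `p`-torsion is `a_ℓ mod p`,
  `trace_galoisRepTorsion_frobenius_eq`); contrapositive certificate `not_modPCongruent_of_frobeniusTrace_ne_of_j_eq`: ONE good prime
  `ℓ` with `a_ℓ(V) ≢ ±a_ℓ(A₀) (mod p)` excludes every curve with `j = j(A₀)` as a mod-`p` anchor of `V`.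

No CM is used: this is congruence-up-to-twist bookkeeping (for the stub's CM anchors, `j(A)` runs over the one or two CM `j` with the
row's field, and `A₀` over explicit minimal models — records in the sibling `…UncongruentRecordsFine`).

HONEST FRAMING (cell `bsd-potss`, run/shared/lean/pub/bsd-potss/; FULL-BSD rank ≤ 1 programme): TOOL THEOREMS ONLY (no definition,
no named fact, no `sorry`, axioms standard). Nothing is booked; crux 19606 stays OPEN; `BSD(W, p)` is claimed for no pair. Seat
`bsd-potss-k8eta-c2` g14 (prover), `--supports stmt-BirchSwinnertonDyer-19606`.

References: [SilvermanAEC2009] X.5 Prop. 5.4, Cor. 5.4.1, III.§7; [Serre1981] §8.1 (238); [Serre1972] §4.5.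
-/

set_option autoImplicit false
set_option linter.dupNamespace false

noncomputable section

open scoped Classical NumberField

open Field IsDedekindDomain NumberField WeierstrassCurve Literature.NumberTheory.EllipticCurves
  Literature.NumberTheory.GaloisRepresentations Rat.HeightOneSpectrum
open Summit.BirchSwinnertonDyer.Rank1Residual.O6 (ModPCongruent)

namespace Summit.BirchSwinnertonDyer.BirchSwinnertonDyer.Theorems.EtaCartanField

/-! ## §1 A congruence to a twist of `A₀` is a twisted isomorphism `V[p] ≅ A₀[p]` -/

/-- Restriction of an additive isomorphism `E : X(ℚ̄) ≃+ Y(ℚ̄)` equivariant up to signs to the `n`-torsion: an additive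
isomorphism `X[n] ≃+ Y[n]` with the same signs. [folklore] -/
theorem exists_torsionIso_of_addEquiv {X Y : WeierstrassCurve ℚ} (E : X.geomPoints ≃+ Y.geomPoints)
    (s : absoluteGaloisGroup ℚ → ℤ) (hE : ∀ (σ : absoluteGaloisGroup ℚ) (P : X.geomPoints), E (σ • P) = s σ • σ • E P) (n : ℤ) :
    ∃ e : X.geomTorsion n ≃+ Y.geomTorsion n,
      ∀ (σ : absoluteGaloisGroup ℚ) (P : X.geomTorsion n), e (σ • P) = s σ • σ • e P := by
  have hmem : ∀ P : X.geomPoints, P ∈ X.geomTorsion n → E P ∈ Y.geomTorsion n := fun P hP => by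
    rw [Submodule.mem_toAddSubgroup, Submodule.mem_torsionBy_iff] at hP ⊢
    change n • E P = 0
    rw [← map_zsmul, show n • P = 0 from hP, map_zero]
  have hmem' : ∀ Q : Y.geomPoints, Q ∈ Y.geomTorsion n → E.symm Q ∈ X.geomTorsion n := fun Q hQ => by
    rw [Submodule.mem_toAddSubgroup, Submodule.mem_torsionBy_iff] at hQ ⊢
    change n • E.symm Q = 0
    rw [← map_zsmul, show n • Q = 0 from hQ, map_zero]
  let f : X.geomTorsion n →+ Y.geomTorsion n :=
    ((E : X.geomPoints →+ Y.geomPoints).comp (X.geomTorsion n).subtype).codRestrict (Y.geomTorsion n)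
      fun P => hmem P.1 P.2
  have hf : ∀ P : X.geomTorsion n, ((f P : Y.geomTorsion n) : Y.geomPoints) = E P := fun _ => rfl
  have hbij : Function.Bijective f := by
    constructor
    · intro P Q h
      apply Subtype.ext
      exact E.injective (by rw [← hf, ← hf, h])
    · intro Q
      refine ⟨⟨E.symm Q, hmem' Q.1 Q.2⟩, Subtype.ext ?_⟩
      rw [hf]
      exact E.apply_symm_apply Q
  refine ⟨AddEquiv.ofBijective f hbij, fun σ P => Subtype.ext ?_⟩
  change ((f (σ • P) : Y.geomTorsion n) : Y.geomPoints) = ((s σ • σ • f P : Y.geomTorsion n) : Y.geomPoints)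
  rw [hf, AddSubgroupClass.coe_zsmul]
  change E (σ • (P : X.geomPoints)) = s σ • σ • ((f P : Y.geomTorsion n) : Y.geomPoints)
  rw [hf, hE]

/-- **A congruence `V[p] ≅ A[p]` with `j(A) = j(A₀) ∉ {0, 1728}` gives a TWISTED isomorphism `V[p] ≅ A₀[p]`**: an additive
isomorphism `e` and `D ∈ ℚ^×` with `e(σP) = ±σ e(P)`, the sign being `+` iff `σ√D = √D` (`A ≅ A₀'^{(D)}` over `ℚ` for the model
`A₀' = toCharNeTwoNF • A₀`, Silverman X.5.4; the twisting isomorphism `A₀'^{(D)} ≅ A₀'` over `ℚ(√D)`, `untwistEquiv`).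
[cite: SilvermanAEC2009, X.5 Prop. 5.4 and Cor. 5.4.1] -/
theorem exists_twistedTorsionIso_of_modPCongruent_of_j_eq {V A A₀ : WeierstrassCurve ℚ} [V.IsElliptic] [A.IsElliptic]
    [A₀.IsElliptic] {p : ℕ} (hVA : ModPCongruent V A p) (hj : A.j = A₀.j) (h0 : A₀.j ≠ 0) (h1728 : A₀.j ≠ 1728) :
    ∃ (D : ℚ) (_ : D ≠ 0) (e : V.geomTorsion p ≃+ A₀.geomTorsion p),
      (∀ (σ : absoluteGaloisGroup ℚ), σ • geomSqrt D = geomSqrt D → ∀ P : V.geomTorsion p, e (σ • P) = σ • e P) ∧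
      (∀ (σ : absoluteGaloisGroup ℚ), σ • geomSqrt D = -geomSqrt D → ∀ P : V.geomTorsion p, e (σ • P) = -(σ • e P)) := by
  letI : Invertible (2 : ℚ) := invertibleOfNonzero two_ne_zero
  set C₀ : VariableChange ℚ := A₀.toCharNeTwoNF with hC₀
  have hj' : A.j = (C₀ • A₀).j := by rw [A₀.variableChange_j C₀]; exact hj
  have h0' : (C₀ • A₀).j ≠ 0 := by rw [A₀.variableChange_j C₀]; exact h0
  have h1728' : (C₀ • A₀).j ≠ 1728 := by rw [A₀.variableChange_j C₀]; exact h1728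
  obtain ⟨D, hD, C, hC⟩ := exists_variableChange_eq_quadraticTwist_of_j_eq hj' h0' h1728'
  -- the sign function
  let s : absoluteGaloisGroup ℚ → ℤ := fun σ => if σ • geomSqrt D = geomSqrt D then 1 else -1
  have hs1 : ∀ σ : absoluteGaloisGroup ℚ, σ • geomSqrt D = geomSqrt D → s σ = 1 := fun σ h => if_pos h
  have hs2 : ∀ σ : absoluteGaloisGroup ℚ, σ • geomSqrt D = -geomSqrt D → s σ = -1 := fun σ h => by
    have h' : ¬ σ • geomSqrt D = geomSqrt D := by rw [h]; exact fun h'' => geomSqrt_ne_neg hD h''.symm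
    exact if_neg h'
  -- `E : A(ℚ̄) ≃+ A₀(ℚ̄)` twisted by `s`
  let E₁ : A.geomPoints ≃+ ((C₀ • A₀).quadraticTwist D).geomPoints := twistPointsIso hC
  let E₂ : ((C₀ • A₀).quadraticTwist D).geomPoints ≃+ (C₀ • A₀).geomPoints := untwistEquiv (C₀ • A₀) hD
  let E₃ : (C₀ • A₀).geomPoints ≃+ A₀.geomPoints := (geomPointsEquiv A₀ C₀).symm
  have hE₃ : ∀ (σ : absoluteGaloisGroup ℚ) (Q : (C₀ • A₀).geomPoints), E₃ (σ • Q) = σ • E₃ Q := fun σ Q => by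
    apply (geomPointsEquiv A₀ C₀).injective
    change (geomPointsEquiv A₀ C₀) ((geomPointsEquiv A₀ C₀).symm (σ • Q)) = _
    rw [AddEquiv.apply_symm_apply, geomPointsEquiv_smul, AddEquiv.apply_symm_apply]
  let E : A.geomPoints ≃+ A₀.geomPoints := E₁.trans (E₂.trans E₃)
  have hE : ∀ (σ : absoluteGaloisGroup ℚ) (P : A.geomPoints), E (σ • P) = s σ • σ • E P := fun σ P => by
    change E₃ (E₂ (E₁ (σ • P))) = s σ • σ • E₃ (E₂ (E₁ P))
    rw [show E₁ (σ • P) = σ • E₁ P from twistPointsIso_smul hC σ P]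
    rcases smul_geomSqrt_eq_or σ D with hσ | hσ
    · rw [show E₂ (σ • E₁ P) = σ • E₂ (E₁ P) from untwistEquiv_smul_of_eq (C₀ • A₀) hD σ hσ _, hE₃, hs1 σ hσ, one_zsmul]
    · rw [show E₂ (σ • E₁ P) = -(σ • E₂ (E₁ P)) from untwistEquiv_smul_of_eq_neg (C₀ • A₀) hD σ hσ _, map_neg, hE₃,
        hs2 σ hσ, neg_one_zsmul]
  obtain ⟨e₀, he₀⟩ := hVA
  obtain ⟨e₁, he₁⟩ := exists_torsionIso_of_addEquiv E s hE p
  refine ⟨D, hD, e₀.trans e₁, fun σ hσ P => ?_, fun σ hσ P => ?_⟩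
  · rw [AddEquiv.trans_apply, he₀, he₁, hs1 σ hσ, one_zsmul, AddEquiv.trans_apply]
  · rw [AddEquiv.trans_apply, he₀, he₁, hs2 σ hσ, neg_one_zsmul, AddEquiv.trans_apply]

/-! ## §2 Traces along a twisted isomorphism -/

/-- **Along an isomorphism `e : V[p] ≃+ A₀[p]` with `e(σP) = s·σ e(P)` (`s ∈ ℤ`) the `𝔽_p`-traces satisfy
`tr(σ | V[p]) = s · tr(σ | A₀[p])`** (`σ|_{V[p]}` is conjugate by `e` to `s·σ|_{A₀[p]}`). [cite: SilvermanAEC2009, III.§7] -/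
theorem trace_eq_mul_trace_of_twistedIso {V A₀ : WeierstrassCurve ℚ} {p : ℕ} [Fact p.Prime]
    (e : V.geomTorsion p ≃+ A₀.geomTorsion p) {σ : absoluteGaloisGroup ℚ} {s : ℤ}
    (he : ∀ P : V.geomTorsion p, e (σ • P) = s • σ • e P) :
    letI : Module (ZMod p) (V.geomTorsion p) := AddSubgroup.torsionBy.zmodModule
    letI : Module (ZMod p) (A₀.geomTorsion p) := AddSubgroup.torsionBy.zmodModule
    LinearMap.trace (ZMod p) (V.geomTorsion p) ((galoisRepTorsion V p σ).toAdd.toAddMonoidHom.toZModLinearMap p) =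
      (s : ZMod p) * LinearMap.trace (ZMod p) (A₀.geomTorsion p)
        ((galoisRepTorsion A₀ p σ).toAdd.toAddMonoidHom.toZModLinearMap p) := by
  letI : Module (ZMod p) (V.geomTorsion p) := AddSubgroup.torsionBy.zmodModule
  letI : Module (ZMod p) (A₀.geomTorsion p) := AddSubgroup.torsionBy.zmodModule
  let eL : V.geomTorsion p ≃ₗ[ZMod p] A₀.geomTorsion p :=
    LinearEquiv.ofBijective (e.toAddMonoidHom.toZModLinearMap p) ⟨e.injective, e.surjective⟩
  have heL : ∀ Q : V.geomTorsion p, eL Q = e Q := fun _ ↦ rfl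
  set TV := (galoisRepTorsion V p σ).toAdd.toAddMonoidHom.toZModLinearMap p with hTV
  set TA := (galoisRepTorsion A₀ p σ).toAdd.toAddMonoidHom.toZModLinearMap p with hTA
  have hconj : eL.conj TV = (s : ZMod p) • TA := by
    refine LinearMap.ext fun Q => ?_
    obtain ⟨P, rfl⟩ := eL.surjective Q
    rw [LinearEquiv.conj_apply_apply, eL.symm_apply_apply, heL, heL, LinearMap.smul_apply, Int.cast_smul_eq_zsmul]
    change e (σ • P) = s • σ • e P
    exact he P
  rw [← LinearMap.trace_conj' TV eL, hconj, map_smul, smul_eq_mul]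

/-! ## §3 `a_ℓ(V) ≡ ±a_ℓ(A₀) (mod p)` -/

/-- **Congruence up to a quadratic twist reads `a_ℓ` up to sign.** Let `V`, `A₀` be globally minimal elliptic curves over `ℚ`, `A`
any elliptic curve with `V[p] ≅ A[p]` (`ModPCongruent V A p`) and `j(A) = j(A₀) ∉ {0, 1728}`. Then at every prime `ℓ ≠ p` of good
reduction for `V` AND `A₀`: `p ∣ a_ℓ(V) − a_ℓ(A₀)` or `p ∣ a_ℓ(V) + a_ℓ(A₀)` — whatever the reduction of `A` at `ℓ` (the trace of an
arithmetic Frobenius at `ℓ` on the `p`-torsion is `a_ℓ mod p` on both sides, `trace_galoisRepTorsion_frobenius_eq`, and the two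
`p`-torsions are isomorphic up to the sign `χ_D(Frob_ℓ)`). [cite: Serre1981, §8.1 (238)] [cite: SilvermanAEC2009, X.5 Cor. 5.4.1] -/
theorem dvd_frobeniusTrace_sub_or_add_of_modPCongruent_of_j_eq (V : WeierstrassCurve ℚ) [V.IsElliptic] [V.IsGloballyMinimal]
    (p : ℕ) [Fact p.Prime] {A : WeierstrassCurve ℚ} [A.IsElliptic] (hVA : ModPCongruent V A p)
    (A₀ : WeierstrassCurve ℚ) [A₀.IsElliptic] [A₀.IsGloballyMinimal] (hj : A.j = A₀.j) (h0 : A₀.j ≠ 0) (h1728 : A₀.j ≠ 1728)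
    (ℓ : ℕ) [hℓ : Fact ℓ.Prime] (hℓp : ℓ ≠ p) (hgoodV : V.HasGoodReductionAtPrime ℓ) (hgoodA : A₀.HasGoodReductionAtPrime ℓ) :
    (p : ℤ) ∣ V.frobeniusTrace ℓ - A₀.frobeniusTrace ℓ ∨ (p : ℤ) ∣ V.frobeniusTrace ℓ + A₀.frobeniusTrace ℓ := by
  letI : Module (ZMod p) (V.geomTorsion p) := AddSubgroup.torsionBy.zmodModule
  letI : Module (ZMod p) (A₀.geomTorsion p) := AddSubgroup.torsionBy.zmodModule
  obtain ⟨D, hD, e, hplus, hminus⟩ := exists_twistedTorsionIso_of_modPCongruent_of_j_eq hVA hj h0 h1728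
  obtain ⟨v, hv⟩ : ∃ v : HeightOneSpectrum (𝓞 ℚ), (primesEquiv v : ℕ) = ℓ :=
    ⟨primesEquiv.symm ⟨ℓ, hℓ.out⟩, by rw [Equiv.apply_symm_apply]⟩
  obtain ⟨𝔓, h𝔓⟩ := v.primesAbove_nonempty
  obtain ⟨σ, hσ⟩ := HeightOneSpectrum.exists_isArithFrobAt_of_mem_primesAbove_holds h𝔓
  have htV := V.trace_galoisRepTorsion_frobenius_eq p hℓp hgoodV hv h𝔓 hσ
  have htA := A₀.trace_galoisRepTorsion_frobenius_eq p hℓp hgoodA hv h𝔓 hσ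
  rcases smul_geomSqrt_eq_or σ D with hσD | hσD
  · left
    have h1 := trace_eq_mul_trace_of_twistedIso e (s := 1) (fun P => by rw [hplus σ hσD P, one_zsmul])
    rw [htV, htA, Int.cast_one, one_mul] at h1
    rw [← ZMod.intCast_zmod_eq_zero_iff_dvd, Int.cast_sub, h1, sub_self]
  · right
    have h1 := trace_eq_mul_trace_of_twistedIso e (s := -1) (fun P => by rw [hminus σ hσD P, neg_one_zsmul])
    rw [htV, htA, Int.cast_neg, Int.cast_one, neg_one_mul] at h1
    rw [← ZMod.intCast_zmod_eq_zero_iff_dvd, Int.cast_add, h1, neg_add_cancel]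

/-- **Certificate**: ONE prime `ℓ ≠ p`, good for `V` and `A₀`, with `a_ℓ(V) ≢ ±a_ℓ(A₀) (mod p)` excludes EVERY elliptic curve `A`
with `j(A) = j(A₀)` (`∉ {0, 1728}`) — all quadratic twists of `A₀`, whatever their bad primes — as a mod-`p` anchor of `V`.
[cite: Serre1981, §8.1 (238)] [cite: SilvermanAEC2009, X.5 Cor. 5.4.1] -/
theorem not_modPCongruent_of_frobeniusTrace_ne_of_j_eq (V : WeierstrassCurve ℚ) [V.IsElliptic] [V.IsGloballyMinimal]
    (p : ℕ) [Fact p.Prime] {A : WeierstrassCurve ℚ} [A.IsElliptic]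
    (A₀ : WeierstrassCurve ℚ) [A₀.IsElliptic] [A₀.IsGloballyMinimal] (hj : A.j = A₀.j) (h0 : A₀.j ≠ 0) (h1728 : A₀.j ≠ 1728)
    (ℓ : ℕ) [Fact ℓ.Prime] (hℓp : ℓ ≠ p) (hgoodV : V.HasGoodReductionAtPrime ℓ) (hgoodA : A₀.HasGoodReductionAtPrime ℓ)
    (h1 : ¬ (p : ℤ) ∣ V.frobeniusTrace ℓ - A₀.frobeniusTrace ℓ) (h2 : ¬ (p : ℤ) ∣ V.frobeniusTrace ℓ + A₀.frobeniusTrace ℓ) :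
    ¬ ModPCongruent V A p := fun hVA =>
  (dvd_frobeniusTrace_sub_or_add_of_modPCongruent_of_j_eq V p hVA A₀ hj h0 h1728 ℓ hℓp hgoodV hgoodA).elim h1 h2

end Summit.BirchSwinnertonDyer.BirchSwinnertonDyer.Theorems.EtaCartanField

end
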